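import Mathlib
import HarnessLib
import Summits.Ventures.LatticeQCDFlow.Scoring.SplitChainTourMoments

/-!
# Tours of the split chain, V: tour sums of different tours are uncorrelated — the cross moment
# `E[S_i · S_{i'}]` factorises through the fresh split chain for `i < i'`

HONEST FRAMING: exact (Metropolis-corrected) sampling algorithms for lattice gauge theory;
figures of merit are autocorrelation/cost numbers at stated couplings and volumes; no
continuum-physics claim.

Venture `LatticeQCDFlow` (cell pub-lqcd), topic `Scoring`; FANOUT row 8 (`s0-cpn-nemc`, GEN-16).
NEW WORK of the cell, not a published result; no definition is introduced.  Notation of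
`Scoring/SplitChainTours.lean`; for a bounded measurable `h : Ω → ℝ` the tour sum of tour `i` is
`S^h_i(x̂) := ∑' u, 1{K_u = i} h(X_u)` (`N_i = S^1_i`).  The random-time regeneration theorem
(`Scoring/SplitChainStrongMarkov.lean`) is applied at the start `τ_{j+1}` of tour `j + 1` with the
UNBOUNDED past weight `S^{h₁}_i`, `i ≤ j` (bounded by `C₁ (t + 1)` on `{τ_{j+1} = t + 1}`, which is all
the theorem needs), and the integrable future functional `S^{h₂}_0`: the cross moment factorises,
`E[S^{h₁}_i · S^{h₂}_{j+1}] = E[S^{h₁}_i] · E_{P̂_ν̂}[S^{h₂}_0]`, from ANY initial law.  With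
`h₂ = f − π(f)` (mean-zero tour sums, `Scoring/SplitChainCycleFormula.lean`) the centred tour sums of
different tours are UNCORRELATED; with `h₁ = h₂ = 1`, `E[N_i N_{i'}] = E[N_i]/ε`.  Printed counterpart
NAMED ONLY: independence of the tours of a split chain (Athreya–Ney 1978; Nummelin 1978;
Mykland–Tierney–Yu 1995 §2) — here in the second-moment form the estimator needs; nothing is cited
as a fact.

## Content (`0 < ε < 1`, any initial law `μ̂₀`; `h, h₁, h₂` bounded measurable)

* **`splitChain_integrable_tourSum`** — every tour sum `S^h_i` is integrable;
* **`splitChain_tour_crossMoment`** — for `i ≤ j`: `S^{h₁}_i · S^{h₂}_{j+1}` is integrable and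
  `E[S^{h₁}_i · S^{h₂}_{j+1}] = E[S^{h₁}_i] · E_{P̂_ν̂}[S^{h₂}_0]`.

NOT CLAIMED: full independence of the tour σ-fields; any `ε` of a concrete sampler.
-/

noncomputable section

namespace Summit.Ventures.LatticeQCDFlow.Scoring

open MeasureTheory ProbabilityTheory Filter Finset Preorder Literature.Probability.MarkovChains
open scoped ENNReal

section Covariance

variable {Ω : Type*} [MeasurableSpace Ω]
  {κ : Kernel Ω Ω} [IsMarkovKernel κ] {ν : Measure Ω} [IsProbabilityMeasure ν] {ε : ℝ≥0∞}
  {hmin : ∀ x {B : Set Ω}, MeasurableSet B → ε * ν B ≤ κ x B}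
  (κs : Kernel (Ω × Bool) (Ω × Bool)) [IsMarkovKernel κs]
  (μs : Measure (Ω × Bool)) [IsProbabilityMeasure μs]

/-- **Every tour sum is integrable** (`0 < ε < 1`, any initial law, `|h| ≤ C` measurable). -/
theorem splitChain_integrable_tourSum (hε0 : 0 < ε) (hε : ε < 1)
    (hκs : ∀ p, κs p = (ε • ν).map (fun y : Ω => (y, true))
      + ((1 - ε) • Doeblin.residualKernel κ ν ε hmin p.1).map (fun y : Ω => (y, false)))
    {h : Ω → ℝ} (hh : Measurable h) {C : ℝ} (hC : ∀ y, |h y| ≤ C) (i : ℕ) :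
    Integrable (fun x : ℕ → Ω × Bool => ∑' u, (if (∑ s ∈ Finset.range u,
        (if (x (s + 1)).2 then (1 : ℕ) else 0)) = i then (1 : ℝ) else 0) * h (x u).1)
      (Kernel.trajMeasure (X := fun _ : ℕ => Ω × Bool) μs
        (fun n : ℕ => κs.comap (fun h : (i : ↥(Finset.Iic n)) → Ω × Bool =>
          h ⟨n, Finset.mem_Iic.2 le_rfl⟩) (measurable_pi_apply _))) := by
  have hψ : Measurable fun pq : (Ω × Bool) × (Ω × Bool) => h pq.1.1 :=
    hh.comp (measurable_fst.comp measurable_fst)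
  -- tour `0`, any initial law: `|S^h_0| ≤ C N_0` almost surely
  have h0 : ∀ (μ' : Measure (Ω × Bool)) [IsProbabilityMeasure μ'],
      Integrable (fun x : ℕ → Ω × Bool => ∑' u, (if (∑ s ∈ Finset.range u,
        (if (x (s + 1)).2 then (1 : ℕ) else 0)) = 0 then (1 : ℝ) else 0) * h (x u).1)
      (Kernel.trajMeasure (X := fun _ : ℕ => Ω × Bool) μ'
        (fun n : ℕ => κs.comap (fun h : (i : ↥(Finset.Iic n)) → Ω × Bool =>
          h ⟨n, Finset.mem_Iic.2 le_rfl⟩) (measurable_pi_apply _))) := by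
    intro μ' _
    obtain ⟨hNi, -⟩ := splitChain_integral_tourLength_zero κs μ' (κ := κ) (ν := ν) (hmin := hmin)
      hε0 hε hκs
    refine Integrable.mono' (hNi.const_mul C) (measurable_tourSum (Ω := Ω)
      (ψ := fun p _ => h p.1) hψ 0).aestronglyMeasurable ?_
    filter_upwards [splitChain_ae_tourStart κs μ' (κ := κ) (ν := ν) (hmin := hmin) hε0 hε hκs]
      with x hx
    obtain ⟨t, ht, hht⟩ := hx 0
    rw [Real.norm_eq_abs]
    exact abs_tourSum_le_tourLength (ψ := fun p _ => h p.1) (fun p _ => hC p.1) x le_rfl ht hht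
  rcases i with _ | j
  · exact h0 μs
  · haveI hνt : IsProbabilityMeasure (ν.map (fun y : Ω => (y, true))) :=
      Measure.isProbabilityMeasure_map (measurable_tagCoin true).aemeasurable
    have key := splitChain_tourFunctional_integrable κs μs (κ := κ) (ν := ν) (hmin := hmin) hε hκs j
      (ψ₁ := fun p _ => h p.1) (ψ₂ := fun p _ => h p.1) hψ hψ (Λ := fun a _ => a) rfl measurable_fst
      (h0 _)
    exact key

/-- **CROSS MOMENTS FACTORISE**: `0 < ε < 1`, any initial law, `h₁, h₂` bounded measurable, `i ≤ j`.
Then `S^{h₁}_i · S^{h₂}_{j+1}` is integrable and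
`E[S^{h₁}_i · S^{h₂}_{j+1}] = E[S^{h₁}_i] · E_{P̂_ν̂}[S^{h₂}_0]` — an earlier tour's sum and a later
tour's sum are uncorrelated once the later one is centred. -/
theorem splitChain_tour_crossMoment (hε0 : 0 < ε) (hε : ε < 1)
    (hκs : ∀ p, κs p = (ε • ν).map (fun y : Ω => (y, true))
      + ((1 - ε) • Doeblin.residualKernel κ ν ε hmin p.1).map (fun y : Ω => (y, false)))
    {h₁ h₂ : Ω → ℝ} (hh₁ : Measurable h₁) (hh₂ : Measurable h₂) {C₁ C₂ : ℝ}
    (hC₁ : ∀ y, |h₁ y| ≤ C₁) (hC₂ : ∀ y, |h₂ y| ≤ C₂) {i j : ℕ} (hij : i ≤ j) :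
    Integrable (fun x : ℕ → Ω × Bool =>
        (∑' u, (if (∑ s ∈ Finset.range u, (if (x (s + 1)).2 then (1 : ℕ) else 0)) = i
          then (1 : ℝ) else 0) * h₁ (x u).1)
        * (∑' u, (if (∑ s ∈ Finset.range u, (if (x (s + 1)).2 then (1 : ℕ) else 0)) = j + 1
          then (1 : ℝ) else 0) * h₂ (x u).1))
      (Kernel.trajMeasure (X := fun _ : ℕ => Ω × Bool) μs
        (fun n : ℕ => κs.comap (fun h : (i : ↥(Finset.Iic n)) → Ω × Bool =>
          h ⟨n, Finset.mem_Iic.2 le_rfl⟩) (measurable_pi_apply _)))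
    ∧ ∫ x, (∑' u, (if (∑ s ∈ Finset.range u, (if (x (s + 1)).2 then (1 : ℕ) else 0)) = i
          then (1 : ℝ) else 0) * h₁ (x u).1)
        * (∑' u, (if (∑ s ∈ Finset.range u, (if (x (s + 1)).2 then (1 : ℕ) else 0)) = j + 1
          then (1 : ℝ) else 0) * h₂ (x u).1)
        ∂(Kernel.trajMeasure (X := fun _ : ℕ => Ω × Bool) μs
          (fun n : ℕ => κs.comap (fun h : (i : ↥(Finset.Iic n)) → Ω × Bool =>
            h ⟨n, Finset.mem_Iic.2 le_rfl⟩) (measurable_pi_apply _)))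
      = (∫ x, ∑' u, (if (∑ s ∈ Finset.range u, (if (x (s + 1)).2 then (1 : ℕ) else 0)) = i
          then (1 : ℝ) else 0) * h₁ (x u).1
          ∂(Kernel.trajMeasure (X := fun _ : ℕ => Ω × Bool) μs
            (fun n : ℕ => κs.comap (fun h : (i : ↥(Finset.Iic n)) → Ω × Bool =>
              h ⟨n, Finset.mem_Iic.2 le_rfl⟩) (measurable_pi_apply _))))
        * ∫ y, ∑' u, (if (∑ s ∈ Finset.range u, (if (y (s + 1)).2 then (1 : ℕ) else 0)) = 0
          then (1 : ℝ) else 0) * h₂ (y u).1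
          ∂(Kernel.trajMeasure (X := fun _ : ℕ => Ω × Bool) (ν.map (fun y : Ω => (y, true)))
            (fun n : ℕ => κs.comap (fun h : (i : ↥(Finset.Iic n)) → Ω × Bool =>
              h ⟨n, Finset.mem_Iic.2 le_rfl⟩) (measurable_pi_apply _))) := by
  haveI hνt : IsProbabilityMeasure (ν.map (fun y : Ω => (y, true))) :=
    Measure.isProbabilityMeasure_map (measurable_tagCoin true).aemeasurable
  set P := Kernel.trajMeasure (X := fun _ : ℕ => Ω × Bool) μs
      (fun n : ℕ => κs.comap (fun h : (i : ↥(Finset.Iic n)) → Ω × Bool =>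
        h ⟨n, Finset.mem_Iic.2 le_rfl⟩) (measurable_pi_apply _)) with hP
  set Pν := Kernel.trajMeasure (X := fun _ : ℕ => Ω × Bool) (ν.map (fun y : Ω => (y, true)))
      (fun n : ℕ => κs.comap (fun h : (i : ↥(Finset.Iic n)) → Ω × Bool =>
        h ⟨n, Finset.mem_Iic.2 le_rfl⟩) (measurable_pi_apply _)) with hPν
  have hC₁0 : 0 ≤ C₁ := (abs_nonneg _).trans (hC₁ (Classical.choice (nonempty_of_isProbabilityMeasure ν)))
  -- the past weights `G_t = 1{K_t = j} · Σ_{u ≤ t} 1{K_u = i} h₁(X_u)`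
  have hGm : ∀ t, Measurable fun x : ℕ → Ω × Bool =>
      (if (∑ s ∈ Finset.range t, (if (x (s + 1)).2 then (1 : ℕ) else 0)) = j then (1 : ℝ) else 0)
      * ∑ u ∈ Finset.range (t + 1), (if (∑ s ∈ Finset.range u,
        (if (x (s + 1)).2 then (1 : ℕ) else 0)) = i then (1 : ℝ) else 0) * h₁ (x u).1 := fun t =>
    (measurable_headCountIndicator t j).mul (Finset.measurable_sum _ fun u _ =>
      (measurable_headCountIndicator u i).mul (hh₁.comp (measurable_fst.comp (measurable_pi_apply u))))
  have hKdep : ∀ (u t : ℕ), u ≤ t → ∀ (x y : ℕ → Ω × Bool), (∀ n ∈ Set.Iic t, x n = y n) →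
      (∑ s ∈ Finset.range u, (if (x (s + 1)).2 then (1 : ℕ) else 0))
        = ∑ s ∈ Finset.range u, (if (y (s + 1)).2 then (1 : ℕ) else 0) := by
    intro u t hut x y hxy
    exact Finset.sum_congr rfl fun s hs => by
      rw [hxy (s + 1) (Set.mem_Iic.2 (by have := Finset.mem_range.1 hs; omega))]
  have hGd : ∀ t, DependsOn (fun x : ℕ → Ω × Bool =>
      (if (∑ s ∈ Finset.range t, (if (x (s + 1)).2 then (1 : ℕ) else 0)) = j then (1 : ℝ) else 0)
      * ∑ u ∈ Finset.range (t + 1), (if (∑ s ∈ Finset.range u,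
        (if (x (s + 1)).2 then (1 : ℕ) else 0)) = i then (1 : ℝ) else 0) * h₁ (x u).1) (Set.Iic t) := by
    intro t x y hxy
    show _ * _ = _ * _
    rw [hKdep t t le_rfl x y hxy]
    congr 1
    exact Finset.sum_congr rfl fun u hu => by
      have hut : u ≤ t := by have := Finset.mem_range.1 hu; omega
      rw [hKdep u t hut x y hxy, hxy u (Set.mem_Iic.2 hut)]
  have hGC : ∀ (t : ℕ) (x : ℕ → Ω × Bool),
      |(if (∑ s ∈ Finset.range t, (if (x (s + 1)).2 then (1 : ℕ) else 0)) = j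
      then (1 : ℝ) else 0) * ∑ u ∈ Finset.range (t + 1), (if (∑ s ∈ Finset.range u,
        (if (x (s + 1)).2 then (1 : ℕ) else 0)) = i then (1 : ℝ) else 0) * h₁ (x u).1|
      ≤ C₁ * (t + 1) := by
    intro t x
    rw [abs_mul]
    have h1 : |(if (∑ s ∈ Finset.range t, (if (x (s + 1)).2 then (1 : ℕ) else 0)) = j
        then (1 : ℝ) else 0)| ≤ 1 := by split_ifs <;> simp
    have h2 : |∑ u ∈ Finset.range (t + 1), (if (∑ s ∈ Finset.range u,
        (if (x (s + 1)).2 then (1 : ℕ) else 0)) = i then (1 : ℝ) else 0) * h₁ (x u).1|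
        ≤ C₁ * (t + 1) := by
      refine (Finset.abs_sum_le_sum_abs _ _).trans ?_
      calc ∑ u ∈ Finset.range (t + 1), |(if (∑ s ∈ Finset.range u,
            (if (x (s + 1)).2 then (1 : ℕ) else 0)) = i then (1 : ℝ) else 0) * h₁ (x u).1|
          ≤ ∑ u ∈ Finset.range (t + 1), C₁ := Finset.sum_le_sum fun u _ => by
            rw [abs_mul]
            calc _ ≤ 1 * C₁ := mul_le_mul (by split_ifs <;> simp) (hC₁ _) (abs_nonneg _) zero_le_one
              _ = C₁ := one_mul _
        _ = C₁ * (t + 1) := by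
          rw [Finset.sum_const, Finset.card_range, nsmul_eq_mul]; push_cast; ring
    calc _ ≤ 1 * (C₁ * (t + 1)) := mul_le_mul h1 h2 (abs_nonneg _) zero_le_one
      _ = C₁ * (t + 1) := one_mul _
  -- the future functional `S^{h₂}_0`
  have hψ₂ : Measurable fun pq : (Ω × Bool) × (Ω × Bool) => h₂ pq.1.1 :=
    hh₂.comp (measurable_fst.comp measurable_fst)
  have hHm := measurable_tourSum (Ω := Ω) (ψ := fun p _ => h₂ p.1) hψ₂ 0
  have hHi := splitChain_integrable_tourSum κs (ν.map (fun y : Ω => (y, true))) (κ := κ) (ν := ν)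
    (hmin := hmin) hε0 hε hκs hh₂ hC₂ 0
  rw [← hPν] at hHi
  -- integrability of the earlier tour sum and of the tour length `N_i`
  have hSi := splitChain_integrable_tourSum κs μs (κ := κ) (ν := ν) (hmin := hmin) hε0 hε hκs hh₁
    hC₁ i
  have hNi := splitChain_integrable_tourSum κs μs (κ := κ) (ν := ν) (hmin := hmin) hε0 hε hκs
    (h := fun _ => (1 : ℝ)) measurable_const (C := 1) (fun _ => by simp) i
  rw [← hP] at hSi hNi
  simp only [mul_one] at hNi
  -- almost surely: the tours end; then the weights pick out `t = τ_{j+1} - 1`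
  have hae := splitChain_ae_tourStart κs μs (κ := κ) (ν := ν) (hmin := hmin) hε0 hε hκs
  rw [← hP] at hae
  -- summability of the weights: partial sums `≤ C₁ E[N_i]`
  have hsum : Summable fun t : ℕ => ∫ x, |(if (∑ s ∈ Finset.range t,
      (if (x (s + 1)).2 then (1 : ℕ) else 0)) = j then (1 : ℝ) else 0)
      * ∑ u ∈ Finset.range (t + 1), (if (∑ s ∈ Finset.range u,
        (if (x (s + 1)).2 then (1 : ℕ) else 0)) = i then (1 : ℝ) else 0) * h₁ (x u).1|
      * (if (x (t + 1)).2 then (1 : ℝ) else 0) ∂P := by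
    have hint : ∀ t, Integrable (fun x : ℕ → Ω × Bool => |(if (∑ s ∈ Finset.range t,
        (if (x (s + 1)).2 then (1 : ℕ) else 0)) = j then (1 : ℝ) else 0)
        * ∑ u ∈ Finset.range (t + 1), (if (∑ s ∈ Finset.range u,
          (if (x (s + 1)).2 then (1 : ℕ) else 0)) = i then (1 : ℝ) else 0) * h₁ (x u).1|
        * (if (x (t + 1)).2 then (1 : ℝ) else 0)) P := fun t => by
      refine integrable_of_bounded P ((hGm t).abs.mul (measurable_coinHeads (t + 1)))
        (C := C₁ * (t + 1) * 1) fun x => ?_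
      rw [abs_mul, abs_abs]
      exact mul_le_mul (hGC t x) (by split_ifs <;> simp) (abs_nonneg _) (by positivity)
    refine summable_of_sum_range_le (c := C₁ * ∫ x, ∑' u, (if (∑ s ∈ Finset.range u,
        (if (x (s + 1)).2 then (1 : ℕ) else 0)) = i then (1 : ℝ) else 0) ∂P)
      (fun t => integral_nonneg fun x => mul_nonneg (abs_nonneg _) (by split_ifs <;> norm_num))
      fun n => ?_
    rw [← integral_finsetSum _ fun t _ => hint t, ← integral_const_mul]
    refine integral_mono_ae (integrable_finsetSum _ fun t _ => hint t) (hNi.const_mul C₁) ?_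
    filter_upwards [hae] with x hx
    obtain ⟨t₀, ht₀, hh₀⟩ := hx j
    -- only `t = t₀` can contribute, and there the weight is `|S^{h₁}_i| ≤ C₁ N_i`
    have hterm : ∀ t, |(if (∑ s ∈ Finset.range t, (if (x (s + 1)).2 then (1 : ℕ) else 0)) = j
        then (1 : ℝ) else 0) * ∑ u ∈ Finset.range (t + 1), (if (∑ s ∈ Finset.range u,
          (if (x (s + 1)).2 then (1 : ℕ) else 0)) = i then (1 : ℝ) else 0) * h₁ (x u).1|
        * (if (x (t + 1)).2 then (1 : ℝ) else 0)
        ≤ if t = t₀ then C₁ * ∑' u, (if (∑ s ∈ Finset.range u,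
          (if (x (s + 1)).2 then (1 : ℕ) else 0)) = i then (1 : ℝ) else 0) else 0 := by
      intro t
      by_cases h1 : (∑ s ∈ Finset.range t, (if (x (s + 1)).2 then (1 : ℕ) else 0)) = j
      · by_cases h2 : (x (t + 1)).2 = true
        · have ht : t = t₀ := tourStart_unique x h1 h2 ht₀ hh₀
          rw [if_pos ht, if_pos h1, if_pos h2, one_mul, mul_one, ← tourSum_eq_finsetSum
            (fun p _ => h₁ p.1) x hij h1 h2]
          exact abs_tourSum_le_tourLength (ψ := fun p _ => h₁ p.1) (fun p _ => hC₁ p.1) x hij h1 h2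
        · rw [if_neg h2, mul_zero]; split_ifs <;> positivity
      · rw [if_neg h1, zero_mul, abs_zero, zero_mul]; split_ifs <;> positivity
    calc _ ≤ ∑ t ∈ Finset.range n, (if t = t₀ then C₁ * ∑' u, (if (∑ s ∈ Finset.range u,
          (if (x (s + 1)).2 then (1 : ℕ) else 0)) = i then (1 : ℝ) else 0) else 0) :=
          Finset.sum_le_sum fun t _ => hterm t
      _ ≤ _ := by
          rw [Finset.sum_ite_eq']
          split_ifs
          · exact le_rfl
          · exact mul_nonneg hC₁0 (tsum_nonneg fun u => by split_ifs <;> norm_num)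
  -- the random-time regeneration theorem at `τ_{j+1}` with these weights
  have key := splitChain_regeneration_randomTime κs μs (κ := κ) (ν := ν) (hmin := hmin) hε hκs hGm
    hGd hGC hHm hHi hsum
  have hTi := splitChain_regeneration_randomTime_integrable κs μs (κ := κ) (ν := ν) (hmin := hmin)
    hε hκs hGm hGd hGC hHm hHi hsum
  rw [← hP] at key hTi
  beta_reduce at key hTi
  -- pathwise identifications on the almost sure set where tour `j + 1` starts
  have hzero : ∀ (x : ℕ → Ω × Bool) (t₀ : ℕ),
      (∑ s ∈ Finset.range t₀, (if (x (s + 1)).2 then (1 : ℕ) else 0)) = j →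
      (x (t₀ + 1)).2 = true → ∀ (w : ℕ → ℝ) (t : ℕ), t ≠ t₀ →
      (if (∑ s ∈ Finset.range t, (if (x (s + 1)).2 then (1 : ℕ) else 0)) = j then (1 : ℝ) else 0)
        * (∑ u ∈ Finset.range (t + 1), (if (∑ s ∈ Finset.range u,
          (if (x (s + 1)).2 then (1 : ℕ) else 0)) = i then (1 : ℝ) else 0) * h₁ (x u).1)
        * (if (x (t + 1)).2 then (1 : ℝ) else 0) * w t = 0 := by
    intro x t₀ ht₀ hh₀ w t hne
    by_cases h1 : (∑ s ∈ Finset.range t, (if (x (s + 1)).2 then (1 : ℕ) else 0)) = j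
    · have h2 : ¬ (x (t + 1)).2 = true := fun h2 => hne (tourStart_unique x h1 h2 ht₀ hh₀)
      rw [if_neg h2, mul_zero, zero_mul]
    · rw [if_neg h1, zero_mul, zero_mul, zero_mul]
  have hpath : ∀ᵐ x ∂P, (∑' t, (if (∑ s ∈ Finset.range t,
      (if (x (s + 1)).2 then (1 : ℕ) else 0)) = j then (1 : ℝ) else 0)
      * (∑ u ∈ Finset.range (t + 1), (if (∑ s ∈ Finset.range u,
        (if (x (s + 1)).2 then (1 : ℕ) else 0)) = i then (1 : ℝ) else 0) * h₁ (x u).1)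
      * (if (x (t + 1)).2 then (1 : ℝ) else 0)
      * ∑' u, (if (∑ s ∈ Finset.range u, (if (x (t + 1 + (s + 1))).2 then (1 : ℕ) else 0)) = 0
        then (1 : ℝ) else 0) * h₂ (x (t + 1 + u)).1)
      = (∑' u, (if (∑ s ∈ Finset.range u, (if (x (s + 1)).2 then (1 : ℕ) else 0)) = i
          then (1 : ℝ) else 0) * h₁ (x u).1)
        * (∑' u, (if (∑ s ∈ Finset.range u, (if (x (s + 1)).2 then (1 : ℕ) else 0)) = j + 1
          then (1 : ℝ) else 0) * h₂ (x u).1) := by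
    filter_upwards [hae] with x hx
    obtain ⟨t₀, ht₀, hh₀⟩ := hx j
    have e1 : (∑ u ∈ Finset.range (t₀ + 1), (if (∑ s ∈ Finset.range u,
        (if (x (s + 1)).2 then (1 : ℕ) else 0)) = i then (1 : ℝ) else 0) * h₁ (x u).1)
        = ∑' u, (if (∑ s ∈ Finset.range u, (if (x (s + 1)).2 then (1 : ℕ) else 0)) = i
          then (1 : ℝ) else 0) * h₁ (x u).1 :=
      (tourSum_eq_finsetSum (fun p _ => h₁ p.1) x hij ht₀ hh₀).symm
    have e2 : (∑' u, (if (∑ s ∈ Finset.range u, (if (x (t₀ + 1 + (s + 1))).2 then (1 : ℕ) else 0))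
        = 0 then (1 : ℝ) else 0) * h₂ (x (t₀ + 1 + u)).1)
        = ∑' u, (if (∑ s ∈ Finset.range u, (if (x (s + 1)).2 then (1 : ℕ) else 0)) = j + 1
          then (1 : ℝ) else 0) * h₂ (x u).1 :=
      (tourSum_transport (fun p _ => h₂ p.1) x ht₀ hh₀).symm
    rw [tsum_eq_single t₀ (hzero x t₀ ht₀ hh₀ _), if_pos ht₀, if_pos hh₀, one_mul, mul_one, e1, e2]
  have hpath' : ∀ᵐ x ∂P, (∑' t, (if (∑ s ∈ Finset.range t,
      (if (x (s + 1)).2 then (1 : ℕ) else 0)) = j then (1 : ℝ) else 0)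
      * (∑ u ∈ Finset.range (t + 1), (if (∑ s ∈ Finset.range u,
        (if (x (s + 1)).2 then (1 : ℕ) else 0)) = i then (1 : ℝ) else 0) * h₁ (x u).1)
      * (if (x (t + 1)).2 then (1 : ℝ) else 0))
      = ∑' u, (if (∑ s ∈ Finset.range u, (if (x (s + 1)).2 then (1 : ℕ) else 0)) = i
          then (1 : ℝ) else 0) * h₁ (x u).1 := by
    filter_upwards [hae] with x hx
    obtain ⟨t₀, ht₀, hh₀⟩ := hx j
    have e1 : (∑ u ∈ Finset.range (t₀ + 1), (if (∑ s ∈ Finset.range u,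
        (if (x (s + 1)).2 then (1 : ℕ) else 0)) = i then (1 : ℝ) else 0) * h₁ (x u).1)
        = ∑' u, (if (∑ s ∈ Finset.range u, (if (x (s + 1)).2 then (1 : ℕ) else 0)) = i
          then (1 : ℝ) else 0) * h₁ (x u).1 :=
      (tourSum_eq_finsetSum (fun p _ => h₁ p.1) x hij ht₀ hh₀).symm
    have h0 := hzero x t₀ ht₀ hh₀ (fun _ => 1)
    simp only [mul_one] at h0
    rw [tsum_eq_single t₀ h0, if_pos ht₀, if_pos hh₀, one_mul, mul_one, e1]
  -- `∑' ∫ (weights) = ∫ S^{h₁}_i`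
  have hint' : ∀ t, Integrable (fun x : ℕ → Ω × Bool => (if (∑ s ∈ Finset.range t,
      (if (x (s + 1)).2 then (1 : ℕ) else 0)) = j then (1 : ℝ) else 0)
      * (∑ u ∈ Finset.range (t + 1), (if (∑ s ∈ Finset.range u,
        (if (x (s + 1)).2 then (1 : ℕ) else 0)) = i then (1 : ℝ) else 0) * h₁ (x u).1)
      * (if (x (t + 1)).2 then (1 : ℝ) else 0)) P := fun t => by
    refine integrable_of_bounded P ((hGm t).mul (measurable_coinHeads (t + 1)))
      (C := C₁ * (t + 1) * 1) fun x => ?_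
    rw [abs_mul]
    exact mul_le_mul (hGC t x) (by split_ifs <;> simp) (abs_nonneg _) (by positivity)
  have hsum' : Summable fun t : ℕ => ∫ x, ‖(if (∑ s ∈ Finset.range t,
      (if (x (s + 1)).2 then (1 : ℕ) else 0)) = j then (1 : ℝ) else 0)
      * (∑ u ∈ Finset.range (t + 1), (if (∑ s ∈ Finset.range u,
        (if (x (s + 1)).2 then (1 : ℕ) else 0)) = i then (1 : ℝ) else 0) * h₁ (x u).1)
      * (if (x (t + 1)).2 then (1 : ℝ) else 0)‖ ∂P := by
    refine hsum.congr fun t => integral_congr_ae (ae_of_all _ fun x => ?_)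
    beta_reduce
    rw [Real.norm_eq_abs, abs_mul _ (if (x (t + 1)).2 then (1 : ℝ) else 0)]
    congr 1
    exact (abs_of_nonneg (by split_ifs <;> norm_num)).symm
  have hGsum : (∑' t, ∫ x, (if (∑ s ∈ Finset.range t,
      (if (x (s + 1)).2 then (1 : ℕ) else 0)) = j then (1 : ℝ) else 0)
      * (∑ u ∈ Finset.range (t + 1), (if (∑ s ∈ Finset.range u,
        (if (x (s + 1)).2 then (1 : ℕ) else 0)) = i then (1 : ℝ) else 0) * h₁ (x u).1)
      * (if (x (t + 1)).2 then (1 : ℝ) else 0) ∂P)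
      = ∫ x, ∑' u, (if (∑ s ∈ Finset.range u, (if (x (s + 1)).2 then (1 : ℕ) else 0)) = i
          then (1 : ℝ) else 0) * h₁ (x u).1 ∂P := by
    rw [integral_tsum_of_summable_integral_norm hint' hsum']
    exact integral_congr_ae hpath'
  refine ⟨hTi.congr hpath, ?_⟩
  rw [← integral_congr_ae hpath, key, hGsum]

end Covariance

end Summit.Ventures.LatticeQCDFlow.Scoring

end
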